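import Summits.QuantumFields.BalabanUV.Beta.D1BFx.LatticeHLSRadial
import Literature.MathematicalPhysics.QuantumFieldTheory.Balaban1983to89.B6QGQDecay237
import Summits.QuantumFields.BalabanUV.Beta.D1BFx.BlockPairRieszCount

/-!
# `BalabanUV.Gaps.BlockPairProfileMass` — cell `pub-balaban-gaps` (YM blitz Y1), track G1, seat g1-p1 (GEN 5), row (D1): the BLOCK-PAIR MASS OF A
# RIESZ × SCALE-EXPONENTIAL PROFILE WITH BLOCK DECAY, in the leg files' block spelling `B6QGQLower276.B n y` — the (A,B)∕(B,A) bubble shape of the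
# road «BF-x» OWNER's PART 24 SPEC v0 §1 (d1-p2 g23, `PART24-SPEC-g23.md` c08ae833fffd2503, pub-balaban journal l.49236), kernel-free: a two-point
# function with `|G x x′| ≤ A₀·e^{−(δ∕(n+1))‖x−x′‖∞}∕nrm(x−x′)^p` (`p ≤ d − 1`) has `Σ_{x∈B n y}Σ_{x′∈B n y′}|G x x′| ≤ A₀·rowConst·e^{2δ}·(n+1)^{2d−p}·e^{−δ‖y−y′‖∞}`
# — `GluonLegBlockMass.sum_B_abs_le_of_profile`'s row count ONE BLOCK DEEPER — with the `d = 4`, `p = 3` reading `≤ 433·A₀·e^{2δ}·n⁵·e^{−δ·dist y y′}`.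

COORDINATION (pub-balaban journal, 2026-08-23): the bare block-PAIR Riesz COUNT («`Σ_{x∈B₀,x′∈B_z} nrm⁻³ ≤ C·n⁵`», SPEC §2) is b2b leaf-04 g25's
`D1BFx/BlockPairRieszCount` (OFFER O-2 l.49512, INTENT-1 l.49582 — FIRST; packed-column spelling `{n•y + toSite b}`); this seat's INTENT I-gapsg1p1-11 (l.49611)
was RE-CUT on leaf-04's word W-2 (l.49628) to the non-duplicated part: `B n y`-spelling block geometry, the one-row window UNIFORM IN THE CENTRE, the profile
forms (own proofs; no import of a file not yet landed).

HONEST FRAMING (cell rule, page 1 of everything).  WHAT THIS IS: elementary counting on `ℤ^d` — sup-norm windows of `PoissonInterior.nrm = max(1, ‖·‖∞)`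
over the blocks `B6QGQLower276.B n y` (side `n + 1`, label `y`; `B (n − 1) β` in `GluonLegBlockMass` ∕ `GhostLegBlockMassD1`), composed BY NAME from leaf-04's
one-centre window `D1BFx.LatticeHLSRadial.sum_inv_nrm_pow_le` and the block geometry `B6QGQDecay237.card_B` ∕ `dist_blk_ge`.  WHAT THIS IS NOT: not a word of
Bałaban's; no kernel of the road is bounded here (the profile is a HYPOTHESIS shape — the one the road's leg letters supply, `GluonLegProfileD1.exists_abs_Ga_diff_le_profile`
(`∕nrm³`), `GluonLegProfile.exists_abs_Ga_le_profile` (`∕nrm²`)); the U1 sizes it serves are the OWNER's reading until the decider; (D1) NOT discharged; 0∕4 row-D1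
binders; (K) NOT closed; NOT `BetaPertH`, NOT the continuum limit, NOT Clay.  HONEST DEPENDENCY (b2b cell, verbatim): «continuum YM on T⁴ ⇐ BetaPertH ∧ nine
spine estimates (0/9 proved); BetaPertH ⇐ (D1) ∧ (D4) ∧ CAP+tail; G-an2-4 gates asym, D1 and NE2/3/4.»

WHY (located).  PART 24 §1 bounds the (A,B)∕(B,A) bubble members of slot (K) in the off-diagonal channel by `Σ_{x∈B₀, x′∈B_z} r⁻³ · (sups) = O(1)` in the EDGE
class, on top of the tables' `e^{−κ|z|}`; a consumer carrying the leg's scale-`n` damping (as the (L1)-MASS letters `GluonLegBlockMass` do) wants the block-PAIR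
mass with the block decay displayed — this file — rather than the bare count.

CONTENT (all [folklore]; constants crude by design; `κ_d := 2d·3^{d−1}` is `PoissonInterior.card_shell_le`'s shell constant and `rowConst d p := 1 + κ_d·2^{d−p}`
is WRITTEN OUT in every statement — no `def`).
* §1 block geometry in the sup-norm currency: `supNorm_sub_le_of_mem_B` (two sites of one block: `‖p − q‖∞ ≤ n`), `dist_eq_supNorm` (Mathlib's sup distance on
  `ℤ^d` is the cast integer sup-norm, any `d ≥ 1`; the `d = 4` case is `GhostLegBlockMass.dist_eq_supNorm`), `supNorm_sub_ge_of_mem_B` (`(n+1)·‖y − y′‖∞ − n ≤ ‖p − q‖∞`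
  across blocks `y`, `y′` — `dist_blk_ge` in the integer currency).
* §2 ONE ROW, UNIFORM IN THE CENTRE: **`sum_B_inv_nrm_pow_le`** — `p ≤ d − 1` ⟹ `Σ_{x′ ∈ B n y′} nrm(x − x′)^{−p} ≤ rowConst d p · (n+1)^{d−p}` for EVERY site `x`
  (in a block or not) and every block (near: the block sits in the window `‖· − x‖∞ ≤ 2n`; far: every term `≤ (n+1)^{−p}`, `(n+1)^d` terms); corollary
  `sum_B_sum_B_inv_nrm_pow_le` (`Σ_{x ∈ B n y} Σ_{x′ ∈ B n y′} ≤ rowConst d p · (n+1)^{2d−p}`, any two blocks — leaf-04's count in this spelling).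
* §3 WITH A RIESZ × SCALE-EXPONENTIAL PROFILE, BLOCK DECAY: **`sum_B_sum_B_abs_le_of_profile`** — `|G x x′| ≤ A₀·e^{−(δ∕(n+1))‖x−x′‖∞}∕nrm(x−x′)^p` (all `x x′`)
  ⟹ `Σ_{x∈B n y} Σ_{x′∈B n y′} |G x x′| ≤ A₀ · rowConst d p · e^{2δ} · (n+1)^{2d−p} · e^{−δ‖y − y′‖∞}` (far blocks `‖y−y′‖∞ ≥ 2`: every term
  `≤ A₀e^{δ}e^{−δ‖y−y′‖∞}∕(n+1)^p`; near blocks: §2 and `1 ≤ e^{2δ}e^{−δ‖y−y′‖∞}`).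
* §4 `d = 4` READING in the road's convention (blocks `B (n − 1) y` of side `n`, `[NeZero n]`, `e^{−(δ∕n)‖·‖∞}`, Mathlib's `dist` on block labels as
  `GluonLegBlockMass` writes it): **`sum_B_sum_B_abs_le_of_profile_four`** — `p = 3` (the Coulomb GRADIENT leg `∕nrm³`): `≤ 433·A₀·e^{2δ}·n⁵·e^{−δ·dist y y′}`;
  `sum_B_sum_B_abs_le_of_profile_four_sq` — `p = 2` (the Coulomb leg `∕nrm²`): `≤ 865·A₀·e^{2δ}·n⁶·e^{−δ·dist y y′}`.
* THE PACKED-COLUMN SPELLING `{n•y + toSite b : b ∈ box d n}` (slot (K)'s words, R-AB BY TERM): by leaf-04 g25's bridge `D1BFx/BlockPairRieszCount.B_eq_image_box` ∕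
  `sum_B_sum_B_eq_sum_box` (INTENT-1 A-2 l.49689) every statement below transports in one `rw`; an APPEND with the transported `d = 4` forms follows that file's ✓
  (no bridge is typed here — theirs was first).
Imports `D1BFx.LatticeHLSRadial` (leaf-04's HLS kit, part 1) and `B6QGQDecay237` (blocks) only; no `def`, no `def … : Prop`, nothing cited, 0 sorry; axioms ⊆ the standard trio.  Provenance: cell pub-balaban-gaps, seat g1-p1 GEN 5, 2026-08-23; INTENT I-gapsg1p1-11 re-cut (A-2).
-/

namespace Summit.QuantumFields.BalabanUV.Gaps.BlockPairProfileMass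

open Finset Real
open Literature.Probability.LatticeModels (Site)
open Literature.MathematicalPhysics.QuantumFieldTheory.Balaban1983to89
open Literature.MathematicalPhysics.QuantumFieldTheory.Balaban1983to89.Beta
open B6QGQLower276 (X blk loc side B mem_B side_mul_blk_add_loc loc_nonneg loc_le)
open B6QGQDecay237 (card_B dist_blk_ge)
open PoissonInterior (supNorm nrm nrm_pos one_le_nrm supNorm_le_nrm nrm_neg supNorm_neg supNorm_add_le natAbs_le_supNorm
  exists_natAbs_eq_supNorm supNorm_le_iff natAbs_le_iff_abs_le)
open Summit.QuantumFields.BalabanUV.Beta.D1BFx.LatticeHLSRadial (sum_inv_nrm_pow_le)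

noncomputable section

variable {d : ℕ}

/-! ## §1 Block geometry in the sup-norm currency -/

/-- [folklore] Two sites of one block differ by at most `n` in every coordinate: `‖p − q‖∞ ≤ n` on `B n y` (side `n + 1`). -/
theorem supNorm_sub_le_of_mem_B {n : ℕ} {y p q : X d} (hp : p ∈ B n y) (hq : q ∈ B n y) : supNorm (p - q) ≤ n := by
  rw [supNorm_le_iff]
  intro i
  have h1 := side_mul_blk_add_loc n p i; have h2 := side_mul_blk_add_loc n q i
  rw [mem_B.1 hp] at h1
  rw [mem_B.1 hq] at h2
  have l1 := loc_nonneg n p i; have l2 := loc_le n p i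
  have l3 := loc_nonneg n q i; have l4 := loc_le n q i
  have e : (p - q) i = loc n p i - loc n q i := by rw [Pi.sub_apply]; linarith
  rw [natAbs_le_iff_abs_le, e, abs_le]
  constructor <;> linarith

/-- [folklore] Mathlib's sup distance on `X d = ℤ^d` (`d ≥ 1`) is the cast integer sup-norm of the difference: `dist p q = ‖p − q‖∞`. -/
theorem dist_eq_supNorm (hd : 0 < d) (p q : X d) : dist p q = (supNorm (p - q) : ℝ) := by
  apply le_antisymm
  · refine (dist_pi_le_iff (by positivity)).2 fun i => ?_
    rw [Int.dist_eq]
    have h : (((p - q) i).natAbs : ℝ) ≤ (supNorm (p - q) : ℝ) := by exact_mod_cast natAbs_le_supNorm (p - q) i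
    have e1 : (((p - q) i).natAbs : ℝ) = |((p i : ℝ) - (q i : ℝ))| := by rw [Nat.cast_natAbs, Int.cast_abs, Pi.sub_apply, Int.cast_sub]
    linarith [e1 ▸ h]
  · obtain ⟨i, hi⟩ := exists_natAbs_eq_supNorm hd (p - q)
    have h := dist_le_pi_dist p q i
    rw [Int.dist_eq] at h
    have e1 : (((p - q) i).natAbs : ℝ) = |((p i : ℝ) - (q i : ℝ))| := by rw [Nat.cast_natAbs, Int.cast_abs, Pi.sub_apply, Int.cast_sub]
    have e2 : (supNorm (p - q) : ℝ) = (((p - q) i).natAbs : ℝ) := by exact_mod_cast hi.symm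
    linarith [e1 ▸ e2]

/-- [folklore] **Lower block distance in the sup-norm currency**: sites of the blocks `y`, `y′` are at sup distance `≥ (n+1)·‖y − y′‖∞ − n`. -/
theorem supNorm_sub_ge_of_mem_B (hd : 0 < d) {n : ℕ} {y y' p q : X d} (hp : p ∈ B n y) (hq : q ∈ B n y') :
    ((n : ℝ) + 1) * (supNorm (y - y') : ℝ) - n ≤ (supNorm (p - q) : ℝ) := by
  have h := dist_blk_ge hp hq
  rwa [dist_eq_supNorm hd, dist_eq_supNorm hd] at h

/-- [folklore] `nrm` is even: `nrm (x − x′) = nrm (x′ − x)`. -/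
theorem nrm_sub_comm (x x' : X d) : nrm (x - x') = nrm (x' - x) := by
  rw [← nrm_neg, neg_sub]

/-! ## §2 One row over a block, uniform in the centre -/

/-- [folklore] The row constant `(1 + 2 * (d : ℝ) * 3 ^ (d - 1) * 2 ^ (d - p)) := 1 + 2d·3^{d−1}·2^{d−p}` (written out in every statement; `= 433` at `d = 4, p = 3`, `= 865` at
`d = 4, p = 2`) is at least `1`. -/
theorem one_le_rowConst (d p : ℕ) : (1 : ℝ) ≤ 1 + 2 * (d : ℝ) * 3 ^ (d - 1) * 2 ^ (d - p) := by
  have : (0 : ℝ) ≤ 2 * (d : ℝ) * 3 ^ (d - 1) * 2 ^ (d - p) := by positivity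
  linarith

/-- [folklore] … and nonnegative. -/
theorem rowConst_nonneg (d p : ℕ) : (0 : ℝ) ≤ 1 + 2 * (d : ℝ) * 3 ^ (d - 1) * 2 ^ (d - p) :=
  zero_le_one.trans (one_le_rowConst d p)

/-- [folklore] **ONE ROW OVER A BLOCK, UNIFORM IN THE CENTRE.**  For a sub-critical Riesz exponent `p ≤ d − 1`, every site `x` and every block `B n y′`
(side `n + 1`): `Σ_{x′ ∈ B n y′} nrm(x − x′)^{−p} ≤ rowConst d p · (n+1)^{d−p}`.  (Near: some site of the block is within `n` of `x`, so the whole block is in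
the window `‖· − x‖∞ ≤ 2n` and leaf-04's `sum_inv_nrm_pow_le` applies; far: every term is `≤ (n+1)^{−p}` and there are `(n+1)^d` of them.) -/
theorem sum_B_inv_nrm_pow_le (hd : 0 < d) {p : ℕ} (hp : p ≤ d - 1) (n : ℕ) (x y' : X d) :
    ∑ x' ∈ B n y', 1 / nrm (x - x') ^ p ≤ (1 + 2 * (d : ℝ) * 3 ^ (d - 1) * 2 ^ (d - p)) * ((n : ℝ) + 1) ^ (d - p) := by
  have hn0 : (0 : ℝ) ≤ n := Nat.cast_nonneg n
  have hn1 : (1 : ℝ) ≤ (n : ℝ) + 1 := by linarith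
  have hpow1 : (1 : ℝ) ≤ ((n : ℝ) + 1) ^ (d - p) := one_le_pow₀ hn1
  by_cases hnear : ∃ x₁ ∈ B n y', supNorm (x - x₁) ≤ n
  · -- NEAR: the whole block lies in the window of radius `2n` around `x`
    obtain ⟨x₁, hx₁, hx₁n⟩ := hnear
    have hR : ∀ x' ∈ B n y', supNorm (x' - x) ≤ 2 * n := by
      intro x' hx'
      have h1 : supNorm (x' - x₁) ≤ n := supNorm_sub_le_of_mem_B hx' hx₁
      have h2 : supNorm (x₁ - x) ≤ n := by rw [← supNorm_neg, neg_sub]; exact hx₁n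
      calc supNorm (x' - x) = supNorm ((x' - x₁) + (x₁ - x)) := by congr 1; abel
        _ ≤ supNorm (x' - x₁) + supNorm (x₁ - x) := supNorm_add_le _ _
        _ ≤ 2 * n := by omega
    have h := sum_inv_nrm_pow_le hd hp (B n y') x hR
    have e : ∀ x' : X d, 1 / nrm (x - x') ^ p = 1 / nrm (x' - x) ^ p := fun x' => by rw [nrm_sub_comm]
    simp_rw [e]
    refine h.trans ?_
    have hB : ((2 * n : ℕ) : ℝ) ^ (d - p) ≤ 2 ^ (d - p) * ((n : ℝ) + 1) ^ (d - p) := by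
      rw [← mul_pow]
      push_cast
      exact pow_le_pow_left₀ (by positivity) (by linarith) _
    have hκ : (0 : ℝ) ≤ 2 * (d : ℝ) * 3 ^ (d - 1) := by positivity
    calc 1 + 2 * d * 3 ^ (d - 1) * ((2 * n : ℕ) : ℝ) ^ (d - p)
        ≤ 1 * ((n : ℝ) + 1) ^ (d - p) + 2 * (d : ℝ) * 3 ^ (d - 1) * (2 ^ (d - p) * ((n : ℝ) + 1) ^ (d - p)) := by
          have := mul_le_mul_of_nonneg_left hB hκ
          linarith
      _ = (1 + 2 * (d : ℝ) * 3 ^ (d - 1) * 2 ^ (d - p)) * ((n : ℝ) + 1) ^ (d - p) := by ring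
  · -- FAR: every site of the block is at sup distance `≥ n + 1` from `x`
    push Not at hnear
    have hpd : p ≤ d := le_trans hp (Nat.sub_le d 1)
    have hterm : ∀ x' ∈ B n y', 1 / nrm (x - x') ^ p ≤ 1 / ((n : ℝ) + 1) ^ p := by
      intro x' hx'
      have h1 : n < supNorm (x - x') := hnear x' hx'
      have h2 : (n : ℝ) + 1 ≤ nrm (x - x') := by
        have h3 : ((n + 1 : ℕ) : ℝ) ≤ (supNorm (x - x') : ℝ) := by exact_mod_cast h1
        push_cast at h3
        exact h3.trans (supNorm_le_nrm _)
      have h4 : ((n : ℝ) + 1) ^ p ≤ nrm (x - x') ^ p := pow_le_pow_left₀ (by positivity) h2 p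
      exact one_div_le_one_div_of_le (by positivity) h4
    calc ∑ x' ∈ B n y', 1 / nrm (x - x') ^ p
        ≤ ∑ _x' ∈ B n y', 1 / ((n : ℝ) + 1) ^ p := Finset.sum_le_sum hterm
      _ = ((n : ℝ) + 1) ^ d * (1 / ((n : ℝ) + 1) ^ p) := by rw [Finset.sum_const, nsmul_eq_mul, card_B]
      _ = ((n : ℝ) + 1) ^ (d - p) := by
          rw [pow_sub₀ _ (by positivity) hpd]
          ring
      _ ≤ (1 + 2 * (d : ℝ) * 3 ^ (d - 1) * 2 ^ (d - p)) * ((n : ℝ) + 1) ^ (d - p) := le_mul_of_one_le_left (by positivity) (one_le_rowConst d p)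

/-- [folklore] **BLOCK PAIRS** (corollary of the one-row bound; the `B n y` spelling of leaf-04 g25's `D1BFx/BlockPairRieszCount` near ∪ far count).  For
`p ≤ d − 1` and ANY two blocks (same, adjacent, edge class, far — no case excluded):
`Σ_{x ∈ B n y} Σ_{x′ ∈ B n y′} nrm(x − x′)^{−p} ≤ rowConst d p · (n+1)^{2d−p}`. -/
theorem sum_B_sum_B_inv_nrm_pow_le (hd : 0 < d) {p : ℕ} (hp : p ≤ d - 1) (n : ℕ) (y y' : X d) :
    ∑ x ∈ B n y, ∑ x' ∈ B n y', 1 / nrm (x - x') ^ p ≤ (1 + 2 * (d : ℝ) * 3 ^ (d - 1) * 2 ^ (d - p)) * ((n : ℝ) + 1) ^ (2 * d - p) := by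
  have hsplit : 2 * d - p = d + (d - p) := by omega
  calc ∑ x ∈ B n y, ∑ x' ∈ B n y', 1 / nrm (x - x') ^ p
      ≤ ∑ _x ∈ B n y, (1 + 2 * (d : ℝ) * 3 ^ (d - 1) * 2 ^ (d - p)) * ((n : ℝ) + 1) ^ (d - p) := Finset.sum_le_sum fun x _ => sum_B_inv_nrm_pow_le hd hp n x y'
    _ = ((n : ℝ) + 1) ^ d * ((1 + 2 * (d : ℝ) * 3 ^ (d - 1) * 2 ^ (d - p)) * ((n : ℝ) + 1) ^ (d - p)) := by rw [Finset.sum_const, nsmul_eq_mul, card_B]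
    _ = (1 + 2 * (d : ℝ) * 3 ^ (d - 1) * 2 ^ (d - p)) * ((n : ℝ) + 1) ^ (2 * d - p) := by rw [hsplit, pow_add]; ring

/-! ## §3 With a Riesz × scale-exponential profile: block decay -/

/-- [folklore] **BLOCK-PAIR MASS FROM A PROFILE, WITH BLOCK DECAY** (the (A,B)∕(B,A) bubble shape of PART 24 §1, kernel-free).  If
`|G x x′| ≤ A₀ · e^{−(δ∕(n+1))·‖x − x′‖∞} ∕ nrm(x − x′)^p` for all `x x′` (`p ≤ d − 1`, `A₀ ≥ 0`, `δ > 0`), then for every pair of blocks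
`Σ_{x ∈ B n y} Σ_{x′ ∈ B n y′} |G x x′| ≤ A₀ · rowConst d p · e^{2δ} · (n+1)^{2d−p} · e^{−δ·‖y − y′‖∞}`. -/
theorem sum_B_sum_B_abs_le_of_profile (hd : 0 < d) {p : ℕ} (hp : p ≤ d - 1) {n : ℕ} {G : X d → X d → ℝ} {A₀ δ : ℝ}
    (hA₀ : 0 ≤ A₀) (hδ : 0 < δ)
    (hprof : ∀ x x' : X d, |G x x'| ≤ A₀ * Real.exp (-(δ / ((n : ℝ) + 1)) * supNorm (x - x')) / nrm (x - x') ^ p)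
    (y y' : X d) :
    ∑ x ∈ B n y, ∑ x' ∈ B n y', |G x x'| ≤
      A₀ * (1 + 2 * (d : ℝ) * 3 ^ (d - 1) * 2 ^ (d - p)) * Real.exp (2 * δ) * ((n : ℝ) + 1) ^ (2 * d - p) * Real.exp (-(δ * supNorm (y - y'))) := by
  have hn0 : (0 : ℝ) ≤ n := Nat.cast_nonneg n; have hn1 : (0 : ℝ) < (n : ℝ) + 1 := by linarith
  have hK := rowConst_nonneg d p; have hK1 := one_le_rowConst d p
  set D : ℕ := supNorm (y - y') with hDdef
  by_cases hfar : 2 ≤ D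
  · -- FAR blocks: every term ≤ A₀·e^{δ}·e^{−δD}/(n+1)^p, and there are (n+1)^{2d} terms
    have hD2 : (2 : ℝ) ≤ D := by exact_mod_cast hfar
    have hterm : ∀ x ∈ B n y, ∀ x' ∈ B n y',
        |G x x'| ≤ A₀ * (Real.exp δ * Real.exp (-(δ * D))) / ((n : ℝ) + 1) ^ p := by
      intro x hx x' hx'
      have hlow : ((n : ℝ) + 1) * (D : ℝ) - n ≤ (supNorm (x - x') : ℝ) := supNorm_sub_ge_of_mem_B hd hx hx'
      have hN : (n : ℝ) + 1 ≤ (supNorm (x - x') : ℝ) := by nlinarith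
      refine (hprof x x').trans ?_
      have hnrm : 0 < nrm (x - x') := nrm_pos _
      rw [div_le_div_iff₀ (by positivity) (by positivity)]
      have hexp : Real.exp (-(δ / ((n : ℝ) + 1)) * supNorm (x - x')) ≤ Real.exp δ * Real.exp (-(δ * D)) := by
        rw [← Real.exp_add]
        apply Real.exp_le_exp.2
        have h1 : δ / ((n : ℝ) + 1) * (((n : ℝ) + 1) * D - n) ≤ δ / ((n : ℝ) + 1) * (supNorm (x - x') : ℝ) :=
          mul_le_mul_of_nonneg_left hlow (div_nonneg hδ.le hn1.le)
        have e2 : δ / ((n : ℝ) + 1) * (((n : ℝ) + 1) * D - n) = δ * D - δ * ((n : ℝ) / ((n : ℝ) + 1)) := by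
          field_simp
        have e3 : δ * ((n : ℝ) / ((n : ℝ) + 1)) ≤ δ := by
          have : (n : ℝ) / ((n : ℝ) + 1) ≤ 1 := by rw [div_le_one hn1]; linarith
          nlinarith
        nlinarith
      have hpoly : ((n : ℝ) + 1) ^ p ≤ nrm (x - x') ^ p :=
        pow_le_pow_left₀ hn1.le (hN.trans (supNorm_le_nrm _)) p
      -- one-step bound (deliberately not a one-line `calc`)
      exact mul_le_mul (mul_le_mul_of_nonneg_left hexp hA₀) hpoly (by positivity) (by positivity)
    have hpd : p ≤ 2 * d := by omega
    have hne : ((n : ℝ) + 1) ≠ 0 := hn1.ne'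
    have epow : ((n : ℝ) + 1) ^ (2 * d - p) = ((n : ℝ) + 1) ^ d * ((n : ℝ) + 1) ^ d / ((n : ℝ) + 1) ^ p := by
      rw [pow_sub₀ _ hne hpd, two_mul, pow_add, div_eq_mul_inv]
    have h1 : Real.exp δ ≤ Real.exp (2 * δ) := Real.exp_le_exp.2 (by linarith)
    have h2 : A₀ * Real.exp δ ≤ A₀ * (1 + 2 * (d : ℝ) * 3 ^ (d - 1) * 2 ^ (d - p)) * Real.exp (2 * δ) := by
      have h3 : A₀ * 1 * Real.exp δ ≤ A₀ * (1 + 2 * (d : ℝ) * 3 ^ (d - 1) * 2 ^ (d - p)) * Real.exp (2 * δ) :=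
        mul_le_mul (mul_le_mul_of_nonneg_left hK1 hA₀) h1 (Real.exp_pos _).le (by positivity)
      simpa using h3
    have h4 : (0 : ℝ) ≤ ((n : ℝ) + 1) ^ (2 * d - p) * Real.exp (-(δ * D)) := by positivity
    refine (Finset.sum_le_sum fun x hx => Finset.sum_le_sum fun x' hx' => hterm x hx x' hx').trans ?_
    calc ∑ _x ∈ B n y, ∑ _x' ∈ B n y', A₀ * (Real.exp δ * Real.exp (-(δ * D))) / ((n : ℝ) + 1) ^ p
        = ((n : ℝ) + 1) ^ d * (((n : ℝ) + 1) ^ d * (A₀ * (Real.exp δ * Real.exp (-(δ * D))) / ((n : ℝ) + 1) ^ p)) := by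
          rw [Finset.sum_const, nsmul_eq_mul, card_B, Finset.sum_const, nsmul_eq_mul, card_B]
      _ = A₀ * Real.exp δ * (((n : ℝ) + 1) ^ (2 * d - p) * Real.exp (-(δ * D))) := by
          rw [epow]
          field_simp
      _ ≤ A₀ * (1 + 2 * (d : ℝ) * 3 ^ (d - 1) * 2 ^ (d - p)) * Real.exp (2 * δ) * (((n : ℝ) + 1) ^ (2 * d - p) * Real.exp (-(δ * D))) :=
          mul_le_mul_of_nonneg_right h2 h4
      _ = A₀ * (1 + 2 * (d : ℝ) * 3 ^ (d - 1) * 2 ^ (d - p)) * Real.exp (2 * δ) * ((n : ℝ) + 1) ^ (2 * d - p) * Real.exp (-(δ * D)) := by ring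
  · -- NEAR blocks (D ≤ 1): drop the exponential, use §3, then 1 ≤ e^{2δ}·e^{−δD}
    push Not at hfar
    have hD2 : (D : ℝ) < 2 := by exact_mod_cast hfar
    have hterm : ∀ x x' : X d, |G x x'| ≤ A₀ * (1 / nrm (x - x') ^ p) := by
      intro x x'
      refine (hprof x x').trans ?_
      have hexp : Real.exp (-(δ / ((n : ℝ) + 1)) * supNorm (x - x')) ≤ 1 := by
        rw [Real.exp_le_one_iff]
        have : 0 ≤ δ / ((n : ℝ) + 1) * (supNorm (x - x') : ℝ) := by positivity
        linarith
      have hnrm : 0 < nrm (x - x') := nrm_pos _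
      rw [mul_one_div]
      exact div_le_div_of_nonneg_right (mul_le_of_le_one_right hA₀ hexp) (by positivity)
    have hexp1 : 1 ≤ Real.exp (2 * δ) * Real.exp (-(δ * D)) := by
      rw [← Real.exp_add, Real.one_le_exp_iff]
      nlinarith
    have hpos : 0 ≤ A₀ * (1 + 2 * (d : ℝ) * 3 ^ (d - 1) * 2 ^ (d - p)) * ((n : ℝ) + 1) ^ (2 * d - p) := by positivity
    have hpull : ∑ x ∈ B n y, ∑ x' ∈ B n y', A₀ * (1 / nrm (x - x') ^ p) = A₀ * ∑ x ∈ B n y, ∑ x' ∈ B n y', 1 / nrm (x - x') ^ p := by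
      rw [Finset.mul_sum]
      exact Finset.sum_congr rfl fun x _ => by rw [Finset.mul_sum]
    have h1 : ∑ x ∈ B n y, ∑ x' ∈ B n y', A₀ * (1 / nrm (x - x') ^ p) ≤ A₀ * ((1 + 2 * (d : ℝ) * 3 ^ (d - 1) * 2 ^ (d - p)) * ((n : ℝ) + 1) ^ (2 * d - p)) := by
      rw [hpull]
      exact mul_le_mul_of_nonneg_left (sum_B_sum_B_inv_nrm_pow_le hd hp n y y') hA₀
    refine (Finset.sum_le_sum fun x _ => Finset.sum_le_sum fun x' _ => hterm x x').trans ?_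
    calc ∑ x ∈ B n y, ∑ x' ∈ B n y', A₀ * (1 / nrm (x - x') ^ p)
        ≤ A₀ * ((1 + 2 * (d : ℝ) * 3 ^ (d - 1) * 2 ^ (d - p)) * ((n : ℝ) + 1) ^ (2 * d - p)) := h1
      _ = A₀ * (1 + 2 * (d : ℝ) * 3 ^ (d - 1) * 2 ^ (d - p)) * ((n : ℝ) + 1) ^ (2 * d - p) * 1 := by ring
      _ ≤ A₀ * (1 + 2 * (d : ℝ) * 3 ^ (d - 1) * 2 ^ (d - p)) * ((n : ℝ) + 1) ^ (2 * d - p) * (Real.exp (2 * δ) * Real.exp (-(δ * D))) :=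
          mul_le_mul_of_nonneg_left hexp1 hpos
      _ = A₀ * (1 + 2 * (d : ℝ) * 3 ^ (d - 1) * 2 ^ (d - p)) * Real.exp (2 * δ) * ((n : ℝ) + 1) ^ (2 * d - p) * Real.exp (-(δ * D)) := by ring

/-! ## §4 The `d = 4` reading in the road's convention: blocks `B (n − 1) y` of side `n`, `[NeZero n]` -/

section Four

variable (n : ℕ) [NeZero n]

/-- [folklore] `((n − 1 : ℕ) : ℝ) + 1 = n` for `n ≥ 1`. -/
theorem cast_pred_add_one : (((n - 1 : ℕ) : ℝ) + 1) = n := by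
  have h : n - 1 + 1 = n := Nat.sub_add_cancel NeZero.one_le
  exact_mod_cast h

/-- [folklore] `rowConst 4 3 = 433`. -/
theorem rowConst_four_three : (1 + 2 * ((4 : ℕ) : ℝ) * 3 ^ (4 - 1) * 2 ^ (4 - 3) : ℝ) = 433 := by norm_num

/-- [folklore] `rowConst 4 2 = 865`. -/
theorem rowConst_four_two : (1 + 2 * ((4 : ℕ) : ℝ) * 3 ^ (4 - 1) * 2 ^ (4 - 2) : ℝ) = 865 := by norm_num

/-- [folklore] **BLOCK-PAIR MASS FROM A `∕nrm³` PROFILE, `d = 4`, WITH BLOCK DECAY, in the road's letters** (profile written in the leg letters' order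
`e^{−(δ∕n)‖x′−x‖∞}∕nrm(x′−x)³` as in `GluonLegProfileD1.exists_abs_Ga_diff_le_profile` — second argument minus first; Mathlib's `dist` on the
block labels as in `GluonLegBlockMass.sum_B_abs_le_of_profile`): `|G x x′| ≤ A₀·e^{−(δ∕n)‖x−x′‖∞}∕nrm(x−x′)³` for all `x x′` ⟹
`Σ_{x ∈ B (n−1) y} Σ_{x′ ∈ B (n−1) y′} |G x x′| ≤ 433·A₀·e^{2δ}·n⁵·e^{−δ·dist y y′}`. -/
theorem sum_B_sum_B_abs_le_of_profile_four {G : X 4 → X 4 → ℝ} {A₀ δ : ℝ} (hA₀ : 0 ≤ A₀) (hδ : 0 < δ)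
    (hprof : ∀ x x' : X 4, |G x x'| ≤ A₀ * Real.exp (-(δ / n) * supNorm (x' - x)) / nrm (x' - x) ^ 3) (y y' : X 4) :
    ∑ x ∈ B (n - 1) y, ∑ x' ∈ B (n - 1) y', |G x x'| ≤
      433 * A₀ * Real.exp (2 * δ) * (n : ℝ) ^ 5 * Real.exp (-(δ * dist y y')) := by
  have hprof' : ∀ x x' : X 4,
      |G x x'| ≤ A₀ * Real.exp (-(δ / ((((n - 1 : ℕ) : ℝ)) + 1)) * supNorm (x - x')) / nrm (x - x') ^ 3 := by
    intro x x'
    rw [cast_pred_add_one n, nrm_sub_comm x x', ← supNorm_neg (x - x'), neg_sub]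
    exact hprof x x'
  have h := sum_B_sum_B_abs_le_of_profile (d := 4) (by norm_num) (p := 3) (by norm_num) hA₀ hδ hprof' y y'
  have e5 : (2 * 4 - 3 : ℕ) = 5 := by norm_num
  rw [cast_pred_add_one n, rowConst_four_three, ← dist_eq_supNorm (by norm_num) y y', e5] at h
  refine h.trans (le_of_eq ?_)
  ring

/-- [folklore] **BLOCK-PAIR MASS FROM A `∕nrm²` PROFILE, `d = 4`** (the undifferentiated Coulomb leg, `GluonLegProfile.exists_abs_Ga_le_profile`'s shape
`kG·e^{−(δ∕n)‖y−x‖∞}∕nrm(y−x)²`): `Σ_{x ∈ B (n−1) y} Σ_{x′ ∈ B (n−1) y′} |G x x′| ≤ 865·A₀·e^{2δ}·n⁶·e^{−δ·dist y y′}` — `GluonLegBlockMass`'s row mass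
`(A_d + 865·A₀)·e^{2δ}·n²·e^{−δ·dist}` summed over the `n⁴` rows of a block, with the block decay kept. -/
theorem sum_B_sum_B_abs_le_of_profile_four_sq {G : X 4 → X 4 → ℝ} {A₀ δ : ℝ} (hA₀ : 0 ≤ A₀) (hδ : 0 < δ)
    (hprof : ∀ x x' : X 4, |G x x'| ≤ A₀ * Real.exp (-(δ / n) * supNorm (x' - x)) / nrm (x' - x) ^ 2) (y y' : X 4) :
    ∑ x ∈ B (n - 1) y, ∑ x' ∈ B (n - 1) y', |G x x'| ≤
      865 * A₀ * Real.exp (2 * δ) * (n : ℝ) ^ 6 * Real.exp (-(δ * dist y y')) := by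
  have hprof' : ∀ x x' : X 4,
      |G x x'| ≤ A₀ * Real.exp (-(δ / ((((n - 1 : ℕ) : ℝ)) + 1)) * supNorm (x - x')) / nrm (x - x') ^ 2 := by
    intro x x'
    rw [cast_pred_add_one n, nrm_sub_comm x x', ← supNorm_neg (x - x'), neg_sub]
    exact hprof x x'
  have h := sum_B_sum_B_abs_le_of_profile (d := 4) (by norm_num) (p := 2) (by norm_num) hA₀ hδ hprof' y y'
  have e6 : (2 * 4 - 2 : ℕ) = 6 := by norm_num
  rw [cast_pred_add_one n, rowConst_four_two, ← dist_eq_supNorm (by norm_num) y y', e6] at h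
  refine h.trans (le_of_eq ?_)
  ring

end Four



/-! ## §5 (APPEND v1.5) The packed-column spelling, by leaf-04 g25's bridge `D1BFx/BlockPairRieszCount.B_eq_image_box` — general two-point summands -/

section Spellings

open AffineAveraging (box toSite)
open Summit.QuantumFields.BalabanUV.Beta.D1BFx.BlockPairRieszCount (B_eq_image_box)

variable (n : ℕ) [NeZero n]

/-- [folklore] `b ↦ N•y + toSite b` is injective on offsets. -/
theorem blockPoint_injective (N : ℤ) (y : X d) : Function.Injective fun b : Fin d → ℕ => N • y + toSite b := by
  intro b b' h
  have h' : toSite b = toSite b' := add_left_cancel h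
  funext i
  have hi := congrFun h' i
  simp only [toSite] at hi
  exact_mod_cast hi

/-- [folklore] **SUMS OF A GENERAL FUNCTION OVER A BLOCK IN EITHER SPELLING** (leaf-04's `B_eq_image_box` + `Finset.sum_image`; their `sum_B_sum_B_eq_sum_box`
is the difference-kernel case): `Σ_{x ∈ B (n−1) y} F x = Σ_{b ∈ box d n} F (n•y + toSite b)` for blocks of side `n`. -/
theorem sum_B_pred_eq_sum_box (y : X d) (F : X d → ℝ) :
    ∑ x ∈ B (n - 1) y, F x = ∑ b ∈ box d n, F ((n : ℤ) • y + toSite b) := by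
  have hn : n - 1 + 1 = n := Nat.sub_add_cancel NeZero.one_le
  rw [B_eq_image_box (n - 1) y, hn]
  exact Finset.sum_image fun b _ b' _ h => blockPoint_injective (n : ℤ) y h

/-- [folklore] **§4 IN THE PACKED-COLUMN SPELLING, `p = 3`**: `Σ_{b,b′ ∈ box 4 n} |G (n•y + toSite b) (n•y′ + toSite b′)| ≤ 433·A₀·e^{2δ}·n⁵·e^{−δ·dist y y′}`
from the `∕nrm³` profile (the form slot (K)'s R-AB words read BY TERM). -/
theorem sum_box_box_abs_le_of_profile_four {G : X 4 → X 4 → ℝ} {A₀ δ : ℝ} (hA₀ : 0 ≤ A₀) (hδ : 0 < δ)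
    (hprof : ∀ x x' : X 4, |G x x'| ≤ A₀ * Real.exp (-(δ / n) * supNorm (x' - x)) / nrm (x' - x) ^ 3) (y y' : X 4) :
    ∑ b ∈ box 4 n, ∑ b' ∈ box 4 n, |G ((n : ℤ) • y + toSite b) ((n : ℤ) • y' + toSite b')| ≤
      433 * A₀ * Real.exp (2 * δ) * (n : ℝ) ^ 5 * Real.exp (-(δ * dist y y')) := by
  have h := sum_B_sum_B_abs_le_of_profile_four n hA₀ hδ hprof y y'
  rw [sum_B_pred_eq_sum_box n y] at h
  simp_rw [sum_B_pred_eq_sum_box n y'] at h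
  exact h

/-- [folklore] **§4 IN THE PACKED-COLUMN SPELLING, `p = 2`**: `≤ 865·A₀·e^{2δ}·n⁶·e^{−δ·dist y y′}` from the `∕nrm²` profile. -/
theorem sum_box_box_abs_le_of_profile_four_sq {G : X 4 → X 4 → ℝ} {A₀ δ : ℝ} (hA₀ : 0 ≤ A₀) (hδ : 0 < δ)
    (hprof : ∀ x x' : X 4, |G x x'| ≤ A₀ * Real.exp (-(δ / n) * supNorm (x' - x)) / nrm (x' - x) ^ 2) (y y' : X 4) :
    ∑ b ∈ box 4 n, ∑ b' ∈ box 4 n, |G ((n : ℤ) • y + toSite b) ((n : ℤ) • y' + toSite b')| ≤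
      865 * A₀ * Real.exp (2 * δ) * (n : ℝ) ^ 6 * Real.exp (-(δ * dist y y')) := by
  have h := sum_B_sum_B_abs_le_of_profile_four_sq n hA₀ hδ hprof y y'
  rw [sum_B_pred_eq_sum_box n y] at h
  simp_rw [sum_B_pred_eq_sum_box n y'] at h
  exact h

end Spellings

end

end Summit.QuantumFields.BalabanUV.Gaps.BlockPairProfileMass
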